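import Summits.BirchSwinnertonDyer.BirchSwinnertonDyer.Theorems.KimAtThreeDeepUpperUnitMinusSymbolAnyLevel
import HarnessLib

/-!
# Route `KimAtThreeKolyvagin` (W2): the CERTIFICATE SUPPLY of ★ PK-6₂ ∘ T-PK6-VDIS on the NON-ADDITIVE rows —
# Kato's auxiliary cusp datum with the NON-ANOMALOUS depletion certificate from one unit minus symbol (any level)

Cell `bsd-addord`, seat `bsd-addord-w2-c4` (gen 8; owner of crux 19599 `ShallowEqDeepOffKatoStratum`, item
19077 `ShallowEqDeepAtTorsionFree`).  `--supports` 19599.  HONEST FRAMING: theorems only (no definition, no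
named fact, no instance, no `sorry`); nothing is booked; 19560 / 19599 / 19077 stay OPEN; BSD is not proved by
any of this.  Credit: the reduction "one unit minus symbol ⟹ Kato's auxiliary datum with unit certificates" is
seat kim3's (gen 10, `KimAtThreeKolyvaginPortSharedCert.certSupply_row_of_unitMinusSymbol`) and the class-wide
unit minus symbol is seat w2-c3's (gen 4 `KimAtThreePortSharedC2Supply.unitMinusSymbol_row`, gen 6
`KimAtThreeDeepUpperUnitMinusSymbolAnyLevel.unitMinusSymbol_row₃` at any level); kim3's proof text ADAPTED.

## What

The seat's non-additive port files (`KimAtThreeShallowEqDeepPortNonAdd{,Unramified}`) display, beside Kato's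
`ZetaBody` + R-κ + the exponent-`1` riders, the CHOOSABLE data of ★ PK-6₂ ∘ T-PK6-VDIS: Kato's auxiliary cusp
datum `(c, d, a, A, d′, aM)` with END-m1's guards, `hcdA`, the 𝔊⁻ certificate and — the one edit — the
NON-ANOMALOUS depletion certificate `v₃(3 · ∏_{q∣3A}(1 − a_q/q + 𝟙_{q∤N}/q)) = 0`.  This file SUPPLIES them on
every non-additive row with `3 ∤ 3 + 𝟙_{3∤N} − a₃` (good NON-anomalous: `#Ẽ(𝔽₃) = 4 − a₃`; multiplicative:
`3 ∓ 1`, always): §2 `certSupply_row_of_unitMinusSymbol_nonAdd` (kim3's reduction with the `q = 3` Euler factor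
`(3 + 𝟙 − a₃)/3` in place of `1`), §3 `certSupply_row_nonAdd` (composed with w2-c3 gen 6's ANY-LEVEL unit minus
symbol `KimAtThreeDeepUpperUnitMinusSymbolAnyLevel.unitMinusSymbol_row₃` (p485088): surj(3) ∧ non-anomalous ⟹ the
full certificate tuple).  COORDINATION: w2-c3 gen 6's companion `…DeepUpperCertSupplyNonAdditive` (19562 side)
states the depletion certificate as `v₃(∏) = α − 1`; this file's `v₃(3·∏) = 0` is the currency of this seat's
`KimAtThreeShallowEqDeepValueRowsNonAdd` / `…PortNonAdd{,Unramified}` (19599 side) — same datum, two spellings.  HONEST LIMITS: supplies DATA only; closes nothing; the additive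
rows are kim3's / w2-c3's originals; good ANOMALOUS rows (`3 ∣ 4 − a₃`) get no certificate (by design: the
non-anomalous certificate is false there).

References: [Kato2004Asterisque] Thm. 6.6 (1) p. 163, Ex. 13.3 pp. 224–225; [Manin1972] Prop. 1.4, Thm. 1.6;
[TateGCFT1967] §2.4; kim3 memo KIM3-W2-PORT-g10 §3; w2-c3 memo W2C3-C2PRIME-CLASSWIDE-g4.
-/

noncomputable section

-- the Theorems namespace of a single-conjunct summit repeats the summit name by design (D-0017)
set_option linter.dupNamespace false

open scoped NumberField TensorProduct Classical MatrixGroups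
open Field Finset IsDedekindDomain NumberField WeierstrassCurve Rat.HeightOneSpectrum
open Literature.NumberTheory.GaloisRepresentations Literature.NumberTheory.GaloisCohomology
open Literature.NumberTheory.GaloisRepresentations.DiscreteGaloisModule
open Literature.NumberTheory.EllipticCurves Literature.NumberTheory.EllipticCurves.ModularForms
open Literature.NumberTheory.EllipticCurves.Rank1Residual
open Literature.NumberTheory.EllipticCurves.Kato2004
open Literature.NumberTheory.EllipticCurves.Kato2004.EulerSystemValues
open Summit.BirchSwinnertonDyer.Rank1Residual.GaloisImage
open Summit.BirchSwinnertonDyer.BirchSwinnertonDyer.Theorems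
open Summit.BirchSwinnertonDyer.BirchSwinnertonDyer.Theorems.KimAtThreeKolyvaginPortSharedCert

namespace Summit.BirchSwinnertonDyer.BirchSwinnertonDyer.Theorems.KimAtThreeShallowEqDeepCertSupplyNonAdd

/-! ### §2 (C2) at a NON-ADDITIVE row from one unit minus symbol (kim3's reduction, `9 ∣ N` ↦ non-anomalous) -/

/-- **(C2) at a NON-ADDITIVE row from ONE unit minus modular symbol** — kim3's
`KimAtThreeKolyvaginPortSharedCert.certSupply_row_of_unitMinusSymbol` with the additive guard `9 ∣ N`
REPLACED by the non-anomalous `q = 3` factor: for the newform `P.f` of a parametrisation datum of `W` at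
ANY level `N`, with `a₃(f) = t₃` and `3 ∤ 3 + 𝟙_{3∤N} − t₃` (`= #Ẽ(𝔽₃) = 4 − a₃` at a good `3`, `3 ∓ 1`
at a multiplicative `3`; FALSE at an additive `3`, where kim3's original applies), a prime `q ≡ 2 (mod 3)`,
`q ∤ N`, `3 ∤ q + 1 − a_q`, an exponent `n ≥ 1` and a numerator `a₀` with `[a₀/q^n]⁻_f` a non-zero `3`-adic
unit yield Kato's auxiliary cusp datum `(c, d, a, A, d′, aM)` with EVERY guard of ★ PK-6₂ ∘ T-PK6-VDIS and
BOTH value certificates in the NON-ANOMALOUS shape of `KimAtThreeShallowEqDeepValueRowsNonAdd`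
(`v₃(3 · ∏_{q∣3A}(1 − a_q/q + 𝟙_{q∤N}/q)) = 0`): `A = q^n`, `a = a₀`, `d′ = 1`, `aM = (q ↦ a_q, else t₃)`,
`c`, `d` primes `≡ 1 (mod A)`, `≡ 2 (mod 3)`, `> 18AN` (Dirichlet); the four-term minus-symbol factor
collapses by periodicity to `cd(c − 1)(d − 1)·[a₀/A]⁻`, the Euler product to `(3 + 𝟙 − t₃)/3 · (q + 1 − a_q)/q`.
Proof text adapted from kim3's (seat kim3 gen 10, p448445's companion).
[cite: Kato2004Asterisque, Thm. 6.6 (1) (p. 163) and Ex. 13.3 (pp. 224–225)] -/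
theorem certSupply_row_of_unitMinusSymbol_nonAdd
    (W : WeierstrassCurve ℚ) [W.IsElliptic] {N : ℕ} [NeZero N] (P : ModularParametrizationData W N)
    {t₃ : ℤ} (ht₃ : cuspCoeff P.f 3 = t₃) (h3a : ¬ (3 : ℤ) ∣ 3 + (if 3 ∣ N then 0 else 1) - t₃)
    {q n : ℕ} (hq : q.Prime) (hq3 : q % 3 = 2) (hqN : ¬ q ∣ N) (hn : 1 ≤ n)
    {t : ℤ} (ht : cuspCoeff P.f q = t) (h3t : ¬ (3 : ℤ) ∣ (q : ℤ) + 1 - t)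
    {a₀ : ℤ} (hX0 : ratMinusSymbol P.f ((a₀ : ℚ) / ((q ^ n : ℕ) : ℚ)) ≠ 0)
    (hX : padicValRat 3 (ratMinusSymbol P.f ((a₀ : ℚ) / ((q ^ n : ℕ) : ℚ))) = 0) :
    ∃ (c d a : ℤ) (A : ℕ) (d' : ℤ) (aM : ℕ → ℤ),
      0 < A ∧ Int.gcd c (6 * 3 * A) = 1 ∧ Int.gcd d (6 * 3 * N) = 1 ∧
      (∀ q : ℕ, q.Prime → q ≡ 1 [MOD 3] → ¬ q ∣ 2 * c.natAbs * d.natAbs * A) ∧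
      Int.gcd (c * d) A = 1 ∧ d * d' ≡ 1 [ZMOD (A : ℤ)] ∧ Nat.Coprime A N ∧
      (∀ q ∈ (3 * A).primeFactors, cuspCoeff P.f q = aM q) ∧
      (∏ q ∈ (3 * A).primeFactors,
          (1 - (aM q : ℚ) / q + (if q ∣ N then 0 else (1 / q : ℚ))) ≠ 0) ∧
      padicValRat 3 ((3 : ℚ) * ∏ q ∈ (3 * A).primeFactors,
          (1 - (aM q : ℚ) / q + (if q ∣ N then 0 else (1 / q : ℚ)))) = 0 ∧
      ((c : ℚ) ^ 2 * (d : ℚ) ^ 2 * ratMinusSymbol P.f ((a : ℚ) / A) -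
          (c : ℚ) * (d : ℚ) ^ 2 * ratMinusSymbol P.f ((a * c : ℚ) / A) -
          (c : ℚ) ^ 2 * (d : ℚ) * ratMinusSymbol P.f ((a * d' : ℚ) / A) +
          (c : ℚ) * (d : ℚ) * ratMinusSymbol P.f ((a * c * d' : ℚ) / A) ≠ 0) ∧
      padicValRat 3 ((c : ℚ) ^ 2 * (d : ℚ) ^ 2 * ratMinusSymbol P.f ((a : ℚ) / A) -
          (c : ℚ) * (d : ℚ) ^ 2 * ratMinusSymbol P.f ((a * c : ℚ) / A) -
          (c : ℚ) ^ 2 * (d : ℚ) * ratMinusSymbol P.f ((a * d' : ℚ) / A) +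
          (c : ℚ) * (d : ℚ) * ratMinusSymbol P.f ((a * c * d' : ℚ) / A)) = 0 := by
  set A : ℕ := q ^ n with hA
  have hA0 : 0 < A := pow_pos hq.pos n
  have hq3' : ¬ 3 ∣ q := by omega
  have hq3ne : q ≠ 3 := by omega
  have hA3 : ¬ 3 ∣ A := fun h => hq3' (Nat.prime_three.dvd_of_dvd_pow h)
  have hN0 : 0 < N := Nat.pos_of_ne_zero (NeZero.ne N)
  -- the auxiliary primes `c`, `d`
  obtain ⟨c, hcB, hcp, hc1, hc2⟩ := exists_prime_gt_modEq_one_modEq_two hA0 hA3 (6 * 3 * A * N)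
  obtain ⟨d, hdB, hdp, hd1, hd2⟩ := exists_prime_gt_modEq_one_modEq_two hA0 hA3 (6 * 3 * A * N)
  have hc3 : c % 3 = 2 := by unfold Int.ModEq at hc2; omega
  have hd3 : d % 3 = 2 := by unfold Int.ModEq at hd2; omega
  have hc0 : (c : ℚ) ≠ 0 := by exact_mod_cast hcp.ne_zero
  have hd0 : (d : ℚ) ≠ 0 := by exact_mod_cast hdp.ne_zero
  have hc1' : (c : ℚ) - 1 ≠ 0 := sub_ne_zero.mpr (by exact_mod_cast hcp.one_lt.ne')
  have hd1' : (d : ℚ) - 1 ≠ 0 := sub_ne_zero.mpr (by exact_mod_cast hdp.one_lt.ne')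
  have hAQ : (A : ℚ) ≠ 0 := by exact_mod_cast hA0.ne'
  -- the symbol and its translates
  set X₁ := ratMinusSymbol P.f ((a₀ : ℚ) / (A : ℚ)) with hX₁
  obtain ⟨k, hk⟩ := hc1.symm.dvd
  have hcq : (c : ℚ) = (A : ℚ) * (k : ℚ) + 1 := by
    have : (c : ℤ) = (A : ℤ) * k + 1 := by linarith
    exact_mod_cast this
  have hX2 : ratMinusSymbol P.f (((a₀ : ℤ) : ℚ) * ((c : ℤ) : ℚ) / (A : ℚ)) = X₁ := by
    have : ((a₀ : ℤ) : ℚ) * ((c : ℤ) : ℚ) / (A : ℚ) = (a₀ : ℚ) / (A : ℚ) + ((a₀ * k : ℤ) : ℚ) := by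
      push_cast
      rw [hcq]
      field_simp
      ring
    rw [this, ratMinusSymbol_add_intCast]
  have hX3 : ratMinusSymbol P.f (((a₀ : ℤ) : ℚ) * ((1 : ℤ) : ℚ) / (A : ℚ)) = X₁ := by
    rw [Int.cast_one, mul_one]
  have hX4 : ratMinusSymbol P.f (((a₀ : ℤ) : ℚ) * ((c : ℤ) : ℚ) * ((1 : ℤ) : ℚ) / (A : ℚ)) = X₁ := by
    rw [Int.cast_one, mul_one, hX2]
  -- the four-term factor collapses
  have hR : ((c : ℤ) : ℚ) ^ 2 * ((d : ℤ) : ℚ) ^ 2 * ratMinusSymbol P.f (((a₀ : ℤ) : ℚ) / (A : ℚ)) -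
      ((c : ℤ) : ℚ) * ((d : ℤ) : ℚ) ^ 2 * ratMinusSymbol P.f (((a₀ : ℤ) : ℚ) * ((c : ℤ) : ℚ) / (A : ℚ)) -
      ((c : ℤ) : ℚ) ^ 2 * ((d : ℤ) : ℚ) * ratMinusSymbol P.f (((a₀ : ℤ) : ℚ) * ((1 : ℤ) : ℚ) / (A : ℚ)) +
      ((c : ℤ) : ℚ) * ((d : ℤ) : ℚ) *
        ratMinusSymbol P.f (((a₀ : ℤ) : ℚ) * ((c : ℤ) : ℚ) * ((1 : ℤ) : ℚ) / (A : ℚ)) =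
      (c : ℚ) * (d : ℚ) * ((c : ℚ) - 1) * ((d : ℚ) - 1) * X₁ := by
    rw [hX2, hX3, hX4]
    push_cast
    ring
  have hRne : (c : ℚ) * (d : ℚ) * ((c : ℚ) - 1) * ((d : ℚ) - 1) * X₁ ≠ 0 :=
    mul_ne_zero (mul_ne_zero (mul_ne_zero (mul_ne_zero hc0 hd0) hc1') hd1') hX0
  have hv3c : padicValRat 3 (c : ℚ) = 0 := by
    rw [padicValRat.of_nat]
    exact_mod_cast padicValNat.eq_zero_of_not_dvd (by omega : ¬ 3 ∣ c)
  have hv3d : padicValRat 3 (d : ℚ) = 0 := by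
    rw [padicValRat.of_nat]
    exact_mod_cast padicValNat.eq_zero_of_not_dvd (by omega : ¬ 3 ∣ d)
  have hv3c1 : padicValRat 3 ((c : ℚ) - 1) = 0 := by
    rw [show (c : ℚ) - 1 = (((c : ℤ) - 1 : ℤ) : ℚ) by push_cast; ring, padicValRat.of_int]
    exact_mod_cast padicValInt.eq_zero_of_not_dvd (by omega : ¬ (3 : ℤ) ∣ (c : ℤ) - 1)
  have hv3d1 : padicValRat 3 ((d : ℚ) - 1) = 0 := by
    rw [show (d : ℚ) - 1 = (((d : ℤ) - 1 : ℤ) : ℚ) by push_cast; ring, padicValRat.of_int]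
    exact_mod_cast padicValInt.eq_zero_of_not_dvd (by omega : ¬ (3 : ℤ) ∣ (d : ℤ) - 1)
  have hRval : padicValRat 3 ((c : ℚ) * (d : ℚ) * ((c : ℚ) - 1) * ((d : ℚ) - 1) * X₁) = 0 := by
    rw [padicValRat.mul (mul_ne_zero (mul_ne_zero (mul_ne_zero hc0 hd0) hc1') hd1') hX0,
      padicValRat.mul (mul_ne_zero (mul_ne_zero hc0 hd0) hc1') hd1',
      padicValRat.mul (mul_ne_zero hc0 hd0) hc1', padicValRat.mul hc0 hd0,
      hv3c, hv3d, hv3c1, hv3d1, hX]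
    norm_num
  -- the prime factors of `3A`
  have hpf : (3 * A).primeFactors = {3, q} := by
    rw [Nat.primeFactors_mul (by norm_num) hA0.ne', Nat.Prime.primeFactors Nat.prime_three, hA,
      Nat.primeFactors_prime_pow (by omega) hq, ← Finset.insert_eq]
  have h3q : (3 : ℕ) ≠ q := fun h => hq3ne h.symm
  -- the `q = 3` Euler factor: `3·(1 − a₃/3 + 𝟙_{3∤N}/3) = 3 + 𝟙_{3∤N} − a₃` (`#Ẽ(𝔽₃)` / `3 ∓ 1`)
  set ε : ℤ := if 3 ∣ N then 0 else 1 with hε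
  have hε3 : (if 3 ∣ N then (0 : ℚ) else (1 / (3 : ℕ) : ℚ)) = (ε : ℚ) / 3 := by
    rw [hε]
    split_ifs <;> push_cast <;> ring
  have hnum3 : ((3 : ℤ) + ε - t₃ : ℤ) ≠ 0 := fun h => h3a (by rw [h]; exact dvd_zero 3)
  -- the Euler product
  set aM : ℕ → ℤ := fun m => if m = q then t else t₃ with haM
  have haM3 : aM 3 = t₃ := by rw [haM]; simp [hq3ne.symm]
  have haMq : aM q = t := by rw [haM]; simp
  have hnum : ((q : ℤ) + 1 - t : ℤ) ≠ 0 := fun h => h3t (h ▸ dvd_zero 3)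
  have hprod : ∏ m ∈ (3 * A).primeFactors,
      (1 - (aM m : ℚ) / m + (if m ∣ N then 0 else (1 / m : ℚ))) =
        ((((3 : ℤ) + ε - t₃ : ℤ) : ℚ) / 3) * ((((q : ℤ) + 1 - t : ℤ) : ℚ) / (q : ℚ)) := by
    rw [hpf, Finset.prod_pair h3q, haM3, haMq, hε3, if_neg hqN]
    have hq0 : (q : ℚ) ≠ 0 := by exact_mod_cast hq.ne_zero
    push_cast
    field_simp
    ring
  have hprod3 : (3 : ℚ) * ∏ m ∈ (3 * A).primeFactors,
      (1 - (aM m : ℚ) / m + (if m ∣ N then 0 else (1 / m : ℚ))) =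
        (((3 : ℤ) + ε - t₃ : ℤ) : ℚ) * ((((q : ℤ) + 1 - t : ℤ) : ℚ) / (q : ℚ)) := by
    rw [hprod]
    ring
  refine ⟨c, d, a₀, A, 1, aM, hA0, ?_, ?_, ?_, ?_, ?_, ?_, ?_, ?_, ?_, ?_, ?_⟩
  · -- `(c, 18A) = 1`
    rw [show (6 * 3 * (A : ℤ) : ℤ) = ((6 * 3 * A : ℕ) : ℤ) by push_cast; ring]
    exact int_gcd_natCast_eq_one_of_prime_of_lt hcp (by positivity) (by nlinarith)
  · -- `(d, 18N) = 1`
    rw [show (6 * 3 * (N : ℤ) : ℤ) = ((6 * 3 * N : ℕ) : ℤ) by push_cast; ring]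
    exact int_gcd_natCast_eq_one_of_prime_of_lt hdp (by positivity) (by nlinarith)
  · -- `hcdA`: the primes dividing `2cdA` are `2, c, d, q`, none `≡ 1 (mod 3)`
    intro r hr hr1 hdvd
    rw [Int.natAbs_natCast, Int.natAbs_natCast] at hdvd
    have hr3 : r % 3 = 1 := hr1
    rcases (Nat.Prime.dvd_mul hr).mp hdvd with h | h
    · rcases (Nat.Prime.dvd_mul hr).mp h with h | h
      · rcases (Nat.Prime.dvd_mul hr).mp h with h | h
        · have := (Nat.prime_dvd_prime_iff_eq hr Nat.prime_two).mp h; omega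
        · have := (Nat.prime_dvd_prime_iff_eq hr hcp).mp h; omega
      · have := (Nat.prime_dvd_prime_iff_eq hr hdp).mp h; omega
    · have := (Nat.prime_dvd_prime_iff_eq hr hq).mp (hr.dvd_of_dvd_pow h); omega
  · -- `(cd, A) = 1`
    obtain ⟨k', hk'⟩ := (hc1.mul hd1).symm.dvd
    refine Int.isCoprime_iff_gcd_eq_one.mp ⟨1, -k', ?_⟩
    linear_combination hk'
  · -- `d · 1 ≡ 1 (mod A)`
    simpa using hd1
  · -- `(A, N) = 1`
    exact Nat.Coprime.pow_left n ((Nat.Prime.coprime_iff_not_dvd hq).mpr hqN)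
  · -- integer models of `a_3(f) = t₃` and `a_q(f) = t`
    intro m hm
    rw [hpf, Finset.mem_insert, Finset.mem_singleton] at hm
    rcases hm with rfl | rfl
    · rw [ht₃, haM3]
    · rw [ht, haMq]
  · -- Euler product non-zero
    rw [hprod]
    exact mul_ne_zero (div_ne_zero (by exact_mod_cast hnum3) three_ne_zero)
      (div_ne_zero (by exact_mod_cast hnum) (by exact_mod_cast hq.ne_zero))
  · -- `3 ·` Euler product a `3`-unit (the non-anomalous certificate)
    rw [hprod3, padicValRat.mul (by exact_mod_cast hnum3)
        (div_ne_zero (by exact_mod_cast hnum) (by exact_mod_cast hq.ne_zero)),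
      padicValRat.div (by exact_mod_cast hnum) (by exact_mod_cast hq.ne_zero),
      padicValRat.of_int, padicValRat.of_int, padicValRat.of_nat, padicValInt.eq_zero_of_not_dvd h3a,
      padicValInt.eq_zero_of_not_dvd h3t, padicValNat.eq_zero_of_not_dvd hq3']
    norm_num
  · -- `R⁻ ≠ 0`
    rw [hR]; exact hRne
  · -- `R⁻` a `3`-unit
    rw [hR]; exact hRval

/-! ### §3 The certificate tuple on a non-additive row from surj(3) and non-anomaly alone -/

/-- **The certificate supply of ★ PK-6₂ ∘ T-PK6-VDIS on a NON-ADDITIVE row**: for `W` with `ρ̄_{E,3}` onto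
and a parametrisation datum `P` at any level `N` whose newform has `3 ∤ 3 + 𝟙_{3∤N} − a₃(f)` (non-anomalous
at a good `3`; automatic at a multiplicative `3`), Kato's auxiliary cusp datum `(c, d, a, A, d′, aM)` with every
guard, `hcdA`, the non-anomalous depletion certificate and the 𝔊⁻ certificate EXISTS — §1 ∘ §2.
[cite: Kato2004Asterisque, Thm. 6.6 (1) (p. 163) and Ex. 13.3 (pp. 224–225)] [cite: Manin1972, Prop. 1.4  Thm. 1.6] -/
theorem certSupply_row_nonAdd (W : WeierstrassCurve ℚ) [W.IsElliptic] [W.IsGloballyMinimal]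
    (hs : W.HasSurjectiveModNGaloisRep (3 : ℕ)) {N : ℕ} [NeZero N] (P : ModularParametrizationData W N)
    {t₃ : ℤ} (ht₃ : cuspCoeff P.f 3 = t₃) (h3a : ¬ (3 : ℤ) ∣ 3 + (if 3 ∣ N then 0 else 1) - t₃) :
    ∃ (c d a : ℤ) (A : ℕ) (d' : ℤ) (aM : ℕ → ℤ),
      0 < A ∧ Int.gcd c (6 * 3 * A) = 1 ∧ Int.gcd d (6 * 3 * N) = 1 ∧
      (∀ q : ℕ, q.Prime → q ≡ 1 [MOD 3] → ¬ q ∣ 2 * c.natAbs * d.natAbs * A) ∧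
      Int.gcd (c * d) A = 1 ∧ d * d' ≡ 1 [ZMOD (A : ℤ)] ∧ Nat.Coprime A N ∧
      (∀ q ∈ (3 * A).primeFactors, cuspCoeff P.f q = aM q) ∧
      (∏ q ∈ (3 * A).primeFactors,
          (1 - (aM q : ℚ) / q + (if q ∣ N then 0 else (1 / q : ℚ))) ≠ 0) ∧
      padicValRat 3 ((3 : ℚ) * ∏ q ∈ (3 * A).primeFactors,
          (1 - (aM q : ℚ) / q + (if q ∣ N then 0 else (1 / q : ℚ)))) = 0 ∧
      ((c : ℚ) ^ 2 * (d : ℚ) ^ 2 * ratMinusSymbol P.f ((a : ℚ) / A) -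
          (c : ℚ) * (d : ℚ) ^ 2 * ratMinusSymbol P.f ((a * c : ℚ) / A) -
          (c : ℚ) ^ 2 * (d : ℚ) * ratMinusSymbol P.f ((a * d' : ℚ) / A) +
          (c : ℚ) * (d : ℚ) * ratMinusSymbol P.f ((a * c * d' : ℚ) / A) ≠ 0) ∧
      padicValRat 3 ((c : ℚ) ^ 2 * (d : ℚ) ^ 2 * ratMinusSymbol P.f ((a : ℚ) / A) -
          (c : ℚ) * (d : ℚ) ^ 2 * ratMinusSymbol P.f ((a * c : ℚ) / A) -
          (c : ℚ) ^ 2 * (d : ℚ) * ratMinusSymbol P.f ((a * d' : ℚ) / A) +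
          (c : ℚ) * (d : ℚ) * ratMinusSymbol P.f ((a * c * d' : ℚ) / A)) = 0 := by
  obtain ⟨q, n, t, a₀, hq, hq3, hqN, hn, ht, h3t, hX0, hX⟩ :=
    KimAtThreeDeepUpperUnitMinusSymbolAnyLevel.unitMinusSymbol_row₃ W hs P
  exact certSupply_row_of_unitMinusSymbol_nonAdd W P ht₃ h3a hq hq3 hqN hn ht h3t hX0 hX

end Summit.BirchSwinnertonDyer.BirchSwinnertonDyer.Theorems.KimAtThreeShallowEqDeepCertSupplyNonAdd

end
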